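import Summits.BirchSwinnertonDyer.Rank1Residual.X11b.TamagawaLocalLemmas
import HarnessLib

/-!
# X11b, route R1 — Tamagawa numbers in a quadratic extension, one rational place at a time

HONEST FRAMING (cell `b2b-bsdres`, verbatim): the goal of the cell is to DELETE the
COMBINATION-SHAPED residual classes for ALL analytic-rank `≤ 1` curves over `ℚ` — "full BSD
formula for every rank `≤ 1` curve in class C" assembled STRICTLY from published theorems — so that
the rank-`≤ 1` remainder becomes exactly the CONSTRUCTION-SHAPED classes, which are TYPED
(missing-input `Prop`s), NOT attempted. This is not "finishing BSD". Sub-cell `b2b-bsdres-multr1-p1`,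
research route R1 for X11b (Castella 2018 Thm. A re-proved along the author's erratum). THEOREMS
ONLY (no `def`, no named fact, nothing asserted); X11b stays CONSTRUCTION-SHAPED.

The per-place heart of the Tamagawa relation (C) of Castella §5 ("the immediate relation
`Σ_{w∣N} c_w(E/K) = Σ_{ℓ∣N} c_ℓ(E/ℚ) + Σ_{ℓ∣N} c_ℓ(E^D/ℚ)`", arXiv:1704.06608 p. 12; CGLS 2022
(5.6); Jetchev–Skinner–Wan 2017 (eq:tamK)), read `p`-adically for `p ≥ 5`, for EVERY elliptic `E/ℚ`
and every quadratic field `K` in which each bad prime `ℓ` either splits or is multiplicative with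
`E[p]` ramified (`p ∤ ord_ℓ(Δ_min)`):

* `ordMinimalDiscriminant_eq_padicValInt` — `ord_v(Δ_min) = ord_q(Δ_min(E))` for globally minimal
  `E/ℚ` at `v ↔ q`; `jHyp_baseChange` — the hypothesis "`ord_v(j) = −n < 0 ⇒ p ∤ n`" passes from
  `v` to a place `w ∣ v` of `K` with `e(w|v) < p` (`|j|_w = |j|_v^e`, Mathlib `valuation_liesOver`);
* `padicValNat_sum_fibre_eq` — for every finite place `v` of `ℚ`:
  `Σ_{w ∣ v} ord_p c_w(E_K) = ord_p c_v(E) + ord_p c_v(E^{(d_K)})` and `ord_p c_v(E^{(d_K)}) =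
  ord_p c_v(E)`. Split `v` (`w₁ ≠ w₂`, `e = f = 1`, `placesOver_trichotomy_of_finrank_eq_two`):
  `c_{w_i}(E_K) = c_v(E)` (`localTamagawaNumber_baseChange_eq_of_degree_one`) and
  `c_v(E^{(d_K)}) = c_v(E)` (`d_K ∈ (ℚ_v^×)²`: `isSquare_padic_discr_of_splitsIn`,
  `localTamagawaNumber_eq_of_twist_of_isSquare`). Non-split `v` (one `w`, `e ∈ {1,2}`): all three
  numbers are `p`-units by Kodaira–Néron (`padicValNat_localTamagawaNumber_eq_zero`): at a good `v`,
  `ord_v(j) ≥ 0` (`valuation_j_le_one_of_hasGoodReductionAt`); at a bad non-split `v`, `E` is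
  multiplicative with `ord_v(j) = −ord_v(Δ_min)` prime to `p` (`valuation_j_eq_exp_ordMinimalDiscriminant`),
  `ord_w(j) = e·ord_v(j)`, and `j(E^{(d)}) = j(E)`.

The global identities and the erratum's link (C) are in `TamagawaQuadraticBaseChange.lean`.
-/

noncomputable section

open scoped Classical

open WeierstrassCurve NumberField IsDedekindDomain Literature.NumberTheory.EllipticCurves
  Literature.NumberTheory.EllipticCurves.Rank1Residual

namespace Summit.BirchSwinnertonDyer.Rank1Residual.X11b

section Bridges

/-- **`ord_v(Δ_min) = ord_q(Δ_min(E))`** for a globally minimal `W/ℚ` at the place `v ↔ q`: the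
place-indexed minimal-discriminant exponent of the tree (`ordMinimalDiscriminant`, through
`valuation_Δ_eq_of_isMinimalAt`) is the `q`-adic valuation of the global minimal discriminant
`minimalDiscriminantInt` (Silverman *AEC* VIII.8: a global minimal equation is minimal at every
prime). [folklore] -/
theorem ordMinimalDiscriminant_eq_padicValInt (W : WeierstrassCurve ℚ) [W.IsElliptic]
    [W.IsGloballyMinimal] (v : HeightOneSpectrum (𝓞 ℚ)) {q : ℕ} [Fact q.Prime]
    (hv : (Rat.HeightOneSpectrum.primesEquiv v : ℕ) = q) :
    W.ordMinimalDiscriminant v = padicValInt q W.minimalDiscriminantInt := by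
  have hgen : Rat.HeightOneSpectrum.natGenerator v = q := hv
  have h1 := valuation_Δ_eq_of_isMinimalAt_holds v W (IsGloballyMinimal.isMinimal v)
  rw [← cast_minimalDiscriminantInt W] at h1
  set n : ℤ := W.minimalDiscriminantInt with hn
  have hn0 : n ≠ 0 := minimalDiscriminantInt_ne_zero W
  set k : ℕ := padicValInt q n with hk
  obtain ⟨u, hu⟩ : (q : ℤ) ^ k ∣ n := padicValInt_dvd n
  have hqu : ¬ (q : ℤ) ∣ u := fun h => by
    have h' : (q : ℤ) ^ (k + 1) ∣ n := by
      rw [hu, pow_succ]; exact mul_dvd_mul_left _ h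
    rcases (padicValInt_dvd_iff (k + 1) n).mp h' with h0 | hle
    · exact hn0 h0
    · omega
  have hval : v.valuation ℚ (n : ℚ) = WithZero.exp (-(k : ℤ)) := by
    rw [hu]
    push_cast
    rw [map_mul, map_pow, ← hgen, Literature.NumberTheory.GaloisRepresentations.Rat.valuation_natGenerator,
      Literature.NumberTheory.GaloisRepresentations.Rat.valuation_intCast_eq_one v (by rwa [hgen]),
      mul_one, ← WithZero.exp_nsmul]
    simp
  rw [hval, WithZero.exp_inj, neg_inj] at h1
  exact_mod_cast h1.symm

/-- **The `p`-adic ramification hypothesis ascends to `K`**: for `w ∣ v` with `0 < e(w|v) < p`, if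
every `n > 0` with `|j(E)|_v = exp(n)` is prime to `p`, then so is every `n > 0` with
`|j(E_K)|_w = exp(n)` — since `|x|_w = |x|_v^{e(w|v)}` on `ℚ` (Mathlib `valuation_liesOver`) and
`j(E_K) = j(E)`. [folklore] -/
theorem jHyp_baseChange (W : WeierstrassCurve ℚ) [W.IsElliptic] (K : Type*) [Field K]
    [NumberField K] [(W.baseChange K).IsElliptic] (w : HeightOneSpectrum (𝓞 K))
    (v : HeightOneSpectrum (𝓞 ℚ)) (hw : w.under (𝓞 ℚ) = v)
    {p e : ℕ} (hpr : p.Prime) (he : w.asIdeal.ramificationIdx (𝓞 ℚ) = e) (he0 : 0 < e)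
    (hep : e < p)
    (H : ∀ n : ℕ, 0 < n → v.valuation ℚ W.j = WithZero.exp (n : ℤ) → ¬ p ∣ n) :
    ∀ n : ℕ, 0 < n → w.valuation K (W.baseChange K).j = WithZero.exp (n : ℤ) → ¬ p ∣ n := by
  intro n hn hval hdvd
  haveI : w.asIdeal.LiesOver v.asIdeal := ⟨by rw [← hw]; rfl⟩
  have hj : (W.baseChange K).j = algebraMap ℚ K W.j := W.map_j _
  have hlo := HeightOneSpectrum.valuation_liesOver K v w W.j
  rw [Ideal.ramificationIdx'_eq_ramificationIdx v.asIdeal w.asIdeal v.ne_bot, he, ← hj, hval] at hlo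
  have hj0 : v.valuation ℚ W.j ≠ 0 := by
    intro h0
    rw [h0, zero_pow he0.ne'] at hlo
    exact WithZero.exp_ne_zero hlo.symm
  obtain ⟨m, hm⟩ : ∃ m : ℤ, v.valuation ℚ W.j = WithZero.exp m :=
    ⟨WithZero.log (v.valuation ℚ W.j), (WithZero.exp_log hj0).symm⟩
  rw [hm, ← WithZero.exp_nsmul, WithZero.exp_inj, nsmul_eq_mul] at hlo
  have hm0 : 0 < m := by
    by_contra hle
    push Not at hle
    have : (e : ℤ) * m ≤ 0 := mul_nonpos_of_nonneg_of_nonpos (by positivity) hle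
    omega
  obtain ⟨m', rfl⟩ : ∃ m' : ℕ, m = m' := ⟨m.toNat, (Int.toNat_of_nonneg hm0.le).symm⟩
  have hm'0 : 0 < m' := by exact_mod_cast hm0
  have hn' : n = e * m' := by exact_mod_cast hlo.symm
  have hpm : ¬ p ∣ m' := H m' hm'0 hm
  rw [hn'] at hdvd
  rcases (Nat.Prime.dvd_mul hpr).mp hdvd with h | h
  · exact absurd (Nat.le_of_dvd he0 h) (by omega)
  · exact hpm h

end Bridges

section PerPlace

/-- **The Tamagawa relation, one rational place at a time.** Let `W/ℚ` be globally minimal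
elliptic, `p ≥ 5`, `K` a quadratic field (`[K:ℚ] = 2`, `d = d_K`) such that at every prime
`ℓ ∣ N_E` which does not split in `K` the reduction is multiplicative with `p ∤ ord_ℓ(Δ_min)`
(`hbad`), and `Wd = C • W^{(d_K)}` an elliptic model of the twist. Then for every finite place `v`
of `ℚ`: `Σ_{w ∣ v} ord_p c_w(E_K) = ord_p c_v(E) + ord_p c_v(E^{(d_K)})` and
`ord_p c_v(E^{(d_K)}) = ord_p c_v(E)`. Split `v`: both places above have `c_w = c_v(E)` and
`c_v(E^{(d)}) = c_v(E)`; non-split `v`: all three are `p`-units (module docstring).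
Castella 2018 §5 "immediate relation"; CGLS 2022 (5.6); JSW 2017 (eq:tamK).
[cite: Castella2018, §5 (arXiv:1704.06608 p. 12), Tamagawa relation] -/
theorem padicValNat_sum_fibre_eq (W : WeierstrassCurve ℚ) [W.IsElliptic] [W.IsGloballyMinimal]
    (p : ℕ) [Fact p.Prime] (hp : 5 ≤ p) (K : Type) [Field K] [NumberField K]
    [(W.baseChange K).IsElliptic] (h2 : Module.finrank ℚ K = 2)
    (hbad : ∀ (ℓ : ℕ) [Fact ℓ.Prime], ℓ ∣ W.conductorNorm ℤ → ¬ SplitsIn K ℓ →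
      Mult W ℓ ∧ ¬ p ∣ padicValInt ℓ W.minimalDiscriminantInt)
    (Wd : WeierstrassCurve ℚ) [Wd.IsElliptic] {C : VariableChange ℚ}
    (hC : C • W.quadraticTwist (NumberField.discr K : ℚ) = Wd) (v : HeightOneSpectrum (𝓞 ℚ)) :
    (∑ w ∈ (HeightOneSpectrum.finite_setOf_under_eq_of_numberField (K := K) v).toFinset,
        padicValNat p (((W.baseChange K).baseChange (w.adicCompletion K)).localTamagawaNumber
          (w.adicCompletionIntegers K)) =
      padicValNat p ((W.baseChange (v.adicCompletion ℚ)).localTamagawaNumber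
          (v.adicCompletionIntegers ℚ)) +
        padicValNat p ((Wd.baseChange (v.adicCompletion ℚ)).localTamagawaNumber
          (v.adicCompletionIntegers ℚ))) ∧
    padicValNat p ((Wd.baseChange (v.adicCompletion ℚ)).localTamagawaNumber
        (v.adicCompletionIntegers ℚ)) =
      padicValNat p ((W.baseChange (v.adicCompletion ℚ)).localTamagawaNumber
        (v.adicCompletionIntegers ℚ)) := by
  have hpr : p.Prime := Fact.out
  set ℓ : ℕ := (Rat.HeightOneSpectrum.primesEquiv v : ℕ) with hℓdef
  haveI hℓ : Fact ℓ.Prime := ⟨(Rat.HeightOneSpectrum.primesEquiv v).2⟩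
  have hvℓ : (Rat.HeightOneSpectrum.primesEquiv v : ℕ) = ℓ := rfl
  have hd : (NumberField.discr K : ℚ) ≠ 0 := by exact_mod_cast NumberField.discr_ne_zero K
  have hfin := HeightOneSpectrum.finite_setOf_under_eq_of_numberField (K := K) v
  -- `j(Wd) = j(W)`
  have hjd : Wd.j = W.j := by
    haveI := W.isElliptic_quadraticTwist hd
    have h0 : ∀ (X : WeierstrassCurve ℚ) [X.IsElliptic],
        X = C • W.quadraticTwist (NumberField.discr K : ℚ) → X.j = W.j := by
      rintro X _ rfl
      rw [variableChange_j, j_quadraticTwist W hd]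
    exact h0 Wd hC.symm
  -- the case of a single place `w` above `v` (inert or ramified): all three numbers are `p`-units
  have key : ∀ (w : HeightOneSpectrum (𝓞 K)) (e : ℕ),
      {w' : HeightOneSpectrum (𝓞 K) | w'.under (𝓞 ℚ) = v} = {w} →
      w.asIdeal.ramificationIdx (𝓞 ℚ) = e → 0 < e → e ≤ 2 →
      (∑ w ∈ hfin.toFinset,
          padicValNat p (((W.baseChange K).baseChange (w.adicCompletion K)).localTamagawaNumber
            (w.adicCompletionIntegers K)) =
        padicValNat p ((W.baseChange (v.adicCompletion ℚ)).localTamagawaNumber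
            (v.adicCompletionIntegers ℚ)) +
          padicValNat p ((Wd.baseChange (v.adicCompletion ℚ)).localTamagawaNumber
            (v.adicCompletionIntegers ℚ))) ∧
      padicValNat p ((Wd.baseChange (v.adicCompletion ℚ)).localTamagawaNumber
          (v.adicCompletionIntegers ℚ)) =
        padicValNat p ((W.baseChange (v.adicCompletion ℚ)).localTamagawaNumber
          (v.adicCompletionIntegers ℚ)) := by
    intro w e hset he he0 he2
    have hw : w.under (𝓞 ℚ) = v := by
      have h : w ∈ ({w} : Set (HeightOneSpectrum (𝓞 K))) := Set.mem_singleton _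
      rwa [← hset] at h
    have hF : hfin.toFinset = {w} := by
      ext w'
      rw [Set.Finite.mem_toFinset, hset]
      simp
    -- `ℓ` does not split in `K`
    have hns : ¬ SplitsIn K ℓ := by
      show ((Ideal.span {(ℓ : ℤ)}).primesOver (𝓞 K)).ncard ≠ 2
      rw [hℓdef, ncard_primesOver_span_eq K v, hset, Set.ncard_singleton]
      decide
    -- the `p`-adic hypothesis on `ord_v j(E)`: `E` is good at `ℓ`, or multiplicative with `p ∤ ord Δ`
    have H : ∀ n : ℕ, 0 < n → v.valuation ℚ W.j = WithZero.exp (n : ℤ) → ¬ p ∣ n := by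
      by_cases hℓN : ℓ ∣ W.conductorNorm ℤ
      · obtain ⟨hmℓ, hvℓN⟩ := hbad ℓ hℓN hns
        have hmv : W.HasMultiplicativeReductionAt v :=
          (hasMultiplicativeReductionAtPrime_primesEquiv_iff_holds W v ℓ hvℓ).mp hmℓ
        intro n hn hval
        rw [valuation_j_eq_exp_ordMinimalDiscriminant v W hmv, WithZero.exp_inj] at hval
        have hn' : n = W.ordMinimalDiscriminant v := by exact_mod_cast hval.symm
        rw [hn', ordMinimalDiscriminant_eq_padicValInt W v hvℓ]
        exact hvℓN
      · have hgood : W.HasGoodReductionAt v :=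
          (hasGoodReductionAtPrime_primesEquiv_iff_holds W v ℓ hvℓ).mp
            (by
              by_contra hbad'
              exact hℓN ((W.dvd_conductorNorm_iff_not_hasGoodReductionAtPrime ℓ).mpr hbad'))
        have hj := Additive.valuation_j_le_one_of_hasGoodReductionAt W v hgood
        intro n hn hval
        exfalso
        rw [hval, ← WithZero.exp_zero, WithZero.exp_le_exp] at hj
        omega
    have hQ := padicValNat_localTamagawaNumber_eq_zero W v hp H
    have hD := padicValNat_localTamagawaNumber_eq_zero Wd v hp (by rw [hjd]; exact H)
    have hKw := padicValNat_localTamagawaNumber_eq_zero (W.baseChange K) w hp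
      (jHyp_baseChange W K w v hw hpr he he0 (by omega) H)
    rw [hF, Finset.sum_singleton, hKw, hQ, hD]
    exact ⟨rfl, rfl⟩
  rcases placesOver_trichotomy_of_finrank_eq_two K h2 v with
    ⟨w₁, w₂, hne, hset, hef⟩ | ⟨w, hset, he, -⟩ | ⟨w, hset, he, -⟩
  · -- split: two places of degree one, and `d_K` is a square in `ℚ_ℓ`
    have hw₁ : w₁.under (𝓞 ℚ) = v := by
      have h : w₁ ∈ ({w₁, w₂} : Set (HeightOneSpectrum (𝓞 K))) := Set.mem_insert _ _
      rwa [← hset] at h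
    have hw₂ : w₂.under (𝓞 ℚ) = v := by
      have h : w₂ ∈ ({w₁, w₂} : Set (HeightOneSpectrum (𝓞 K))) :=
        Set.mem_insert_of_mem _ (Set.mem_singleton _)
      rwa [← hset] at h
    obtain ⟨he₁, hf₁⟩ := hef w₁ hw₁
    obtain ⟨he₂, hf₂⟩ := hef w₂ hw₂
    have hF : hfin.toFinset = {w₁, w₂} := by
      ext w
      rw [Set.Finite.mem_toFinset, hset]
      simp
    have hs : SplitsIn K ℓ := by
      show ((Ideal.span {(ℓ : ℤ)}).primesOver (𝓞 K)).ncard = 2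
      rw [hℓdef, ncard_primesOver_span_eq K v, hset, Set.ncard_pair hne]
    have hsq := isSquare_padic_discr_of_splitsIn h2 hs
    have c₁ := localTamagawaNumber_baseChange_eq_of_degree_one W w₁ he₁ hf₁
    have c₂ := localTamagawaNumber_baseChange_eq_of_degree_one W w₂ he₂ hf₂
    rw [hw₁] at c₁
    rw [hw₂] at c₂
    rw [hF, Finset.sum_pair hne, c₁, c₂,
      localTamagawaNumber_eq_of_twist_of_isSquare W v hvℓ hd hsq Wd hC]
    exact ⟨rfl, rfl⟩
  · exact key w 1 hset he one_pos (by norm_num)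
  · exact key w 2 hset he two_pos le_rfl

end PerPlace

end Summit.BirchSwinnertonDyer.Rank1Residual.X11b

end
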